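import Summits.AtomisticToContinuum.HydrodynamicLimit.Theorems.CollisionIsometryCLTCollisionalTransferLocalityDefsE
import Summits.AtomisticToContinuum.HydrodynamicLimit.Theorems.CollisionIsometryCLTCollisionalTransferLocalityBlockFields
import Summits.AtomisticToContinuum.HydrodynamicLimit.Theorems.CollisionIsometryCLTCollisionalTransferLocalityChannelAdditivity
import Summits.AtomisticToContinuum.HydrodynamicLimit.Theorems.CollisionIsometryCLTCollisionalTransferLocalityMollCeilingOfBlockCeiling
import Summits.AtomisticToContinuum.HydrodynamicLimit.Theorems.CollisionIsometryCLTCollisionalTransferLocalityMarkSumAInert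
import Summits.AtomisticToContinuum.HydrodynamicLimit.Theorems.CollisionIsometryCLTCollisionalTransferLocalityConeValue
import Summits.AtomisticToContinuum.HydrodynamicLimit.Theses.JParityClosure
import Summits.AtomisticToContinuum.HydrodynamicLimit.Theorems.JParityClosureParityBandClosurePressureValueDeterministic
import Summits.AtomisticToContinuum.HydrodynamicLimit.Theorems.JParityClosureParityBandClosurePressureValueOfEvenStress
import Literature.MathematicalPhysics.KineticTheory.EvenCollisionTubeFunctional
import HarnessLib

/-!
# [DockA] The fixed-time momentum law [KσA] from the sibling crux `EvenStressEnskog` and the two-scale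
# statement [TS] (registered stub `stub_stressLawFixedA_of_evenStressEnskog`, line `hemisphere-affine-slaving`,
# crux `CollisionalTransferLocality`, stmt-AtomisticToContinuum-9518)

Supporting file (`--supports stmt-AtomisticToContinuum-9518`) proving the registered assembly stub [DockA] VERBATIM:
`JParityClosure.EvenStressEnskog` (stmt-13079, hypothesis `h79`, BY NAME) and the two-scale value statement [TS]
(second hypothesis: `(RhsA + KfunA)[b_r] ≈ (RhsA + KfunA)[φ_N]` w.h.p., `N → ∞` before `r → 0`) imply the
fixed-time momentum law `StressLawFixedAAt` (…DefsE) for every smooth matrix weight `A`, with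
`σ₀ := min σ₀^{13079} σ₀^{TS} (1/2)`, `η₁ := min η₁^{TS} (η₀'/8)`, `η₀' := min η₀^{13079} η_B`, `η_B` a band on which
the contact value `Y = (3/2π) f_ex′` has a continuous extension `Ỹ` (`hsEosLowDensity_proof`).

Proof. `τ = 0`: `M_N^A(0) = 0` (no collision time in `(0, 0]`), `RhsA(0) = KfunA(0) = 0` (null window) — empty
event. `0 < τ`, tolerance `e`: window cutoff `g(a) = max 0 (min 1 (2 − 2a/η₀'))` (continuous, `= 0` on `[η₀, ∞)`,
`= 1` where `2a ≤ η₀'`), clamped weights `χ_kl(s, x) = A(projIcc_{[0,t]} s, x)_kl` (jointly continuous,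
`continuous_comp_projIcc`; `= A_kl` on `[0, t]`); radii from nine instances of 13079 (weights `χ_kl`, level `δ/30`,
probability `e/11`) and one of [TS] (level `δ/3`); particle numbers from those, from `DiluteAt` and from
`(N+1)^{-γ} < min r (r/(c+1))` (`c` of [CeilR]). The target event is then covered (`measure_le_of_imp3`) by the
NULL set "bad set ∪ contact sets" (`localGibbsLaw_compl_good'`, `localGibbsLaw_contactSet`), the dilute event, the
[TS] event and the nine 13079 events (total `≤ 11 · e/11`), by the DETERMINISTIC CORE `DockA.core_bound` on a good
datum off all of them: (i) [CeilR] `stub_mollDensity_le_of_blockCeiling`: the block ceiling `ρ̄σ³ ≤ η₁` gives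
`σ³ρ_r ≤ 2η₁ ≤ η₀'/4` along the orbit, so `g(σ³ρ_r) = 1` (inert cutoff); (ii) [DψA']
`stub_markSumA_eq_evenCollisionSums_of_inert`: `M_N^A(τ) = ½ Σ_kl K_kl(τ)` (weights `A_kl = χ_kl` on `[0, τ]`,
`collisionSum_congr_weight`; `K_kl(0) = 0` off the contact sets, `collisionSum_at_zero`); (iii) the nine statistics:
`|Σ_kl K_kl(τ) − Σ_kl σ³∫₀^τ e_kl| ≤ 9δ/30`; (iv) the landed identity `ParityBandClosurePressureValue.sum_enskog_integral_eq`
writes `Σ_kl σ³∫₀^τ e_kl = 2 I₁ + (8π/15) I₂`, and [ConeVal] `stub_coneValue_eq` identifies POINTWISE along the orbit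
(`g = 1`; `ρ̄[b_r] = ρ_r`, `θ̄[b_r] = θ_r`: `ConeValue.rhoB_cone`, `ConeValue.thetaB_cone`) the integrand of `I₁` with `tr A · p_c(ρ̄, θ̄)`
and `(4π/15)×` that of `I₂` with `kinWA · p_c` on the cone-kernel block fields, so `I₁ + (4π/15) I₂ = (RhsA + KfunA)[b_r](τ)`
by pointwise congruences only (no exchange of integrals); (v) [TS]: `|M_N^A(τ) − (RhsA + KfunA)[φ_N](τ)| ≤ 9δ/60 + δ/3 < δ`.
No new definitions; axioms `propext`, `Classical.choice`, `Quot.sound`. Background: Chapman–Cowling (1970) §16.4;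
van Beijeren–Ernst, Physica 68 (1973) 437; Cercignani–Illner–Pulvirenti (1994) §4.2.
-/

namespace Summit.AtomisticToContinuum.HydrodynamicLimit.Theorems.HemisphereAffineSlaving

open scoped BigOperators Topology Classical ENNReal InnerProductSpace
open Filter Set Function MeasureTheory

noncomputable section

open Literature.MathematicalPhysics.KineticTheory (T3 V3 hsDiameter coneKernel mollDensity mollTemperature
  mollMomentum evenMark evenStat enskogRate collisionSum contactValue hsPressure localGibbsLaw)
open Literature.Analysis.FluidPDE (HardSphereFlow contactSet collisionTimes)

namespace DockA

/-! ## Plumbing -/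

/-- An `e`–`N₀` bound at every real level `e > 0` gives convergence to `0` in `ℝ≥0∞`. [folklore] -/
theorem tendsto_zero_of_le_ofReal {f : ℕ → ℝ≥0∞}
    (h : ∀ e : ℝ, 0 < e → ∃ N₀ : ℕ, ∀ N, N₀ ≤ N → f N ≤ ENNReal.ofReal e) : Tendsto f atTop (𝓝 0) := by
  refine ENNReal.tendsto_atTop_zero.2 fun ε hε => ?_
  rcases eq_or_ne ε ⊤ with rfl | hne
  · exact ⟨0, fun _ _ => le_top⟩
  · obtain ⟨N₀, hN₀⟩ := h ε.toReal (ENNReal.toReal_pos hε.ne' hne)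
    exact ⟨N₀, fun N hN => (hN₀ N hN).trans (ENNReal.ofReal_toReal hne).le⟩

/-- Two tolerances of `e/11` and nine more make `e`. [folklore] -/
theorem two_add_nine (e : ℝ) (he : 0 ≤ e) :
    ENNReal.ofReal (e / 11) + (ENNReal.ofReal (e / 11) + ∑ _p : Fin 3 × Fin 3, ENNReal.ofReal (e / 11)) =
      ENNReal.ofReal e := by
  rw [← ENNReal.ofReal_sum_of_nonneg fun _ _ => by positivity,
    ← ENNReal.ofReal_add (by positivity) (Finset.sum_nonneg fun _ _ => by positivity),
    ← ENNReal.ofReal_add (by positivity) (by positivity)]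
  simp only [Finset.sum_const, Finset.card_univ, Fintype.card_prod, Fintype.card_fin, nsmul_eq_mul]
  exact congrArg ENNReal.ofReal (by push_cast; ring)

/-- A continuous function on `ℝ` agreeing with the contact value `Y = (3/2π) f_ex′` on a band `(0, η_B)`
(`hsEosLowDensity_proof`: `f_ex = F` analytic on `(-η_A, η_A)`; clamp the argument). [folklore] -/
theorem exists_band_function : ∃ ηB : ℝ, 0 < ηB ∧ ∃ Yt : ℝ → ℝ, Continuous Yt ∧
    ∀ b ∈ Ioo 0 ηB, Yt b = contactValue b := by
  -- adapted from the proof of `ParityBandClosurePressureValue.stub_pressureValueOfEvenStress`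
  obtain ⟨ηA, hηA, F, hFan, hFeq, -, -, -⟩ :=
    Summit.AtomisticToContinuum.HydrodynamicLimit.Theorems.hsEosLowDensity_proof
  refine ⟨ηA / 2, half_pos hηA, fun b => 3 / (2 * Real.pi) * deriv F (max (min b (ηA / 2)) 0), ?_, ?_⟩
  · have hclamp : ∀ b : ℝ, max (min b (ηA / 2)) 0 ∈ Ioo (-ηA) ηA := fun b =>
      ⟨lt_of_lt_of_le (by linarith) (le_max_right _ _), max_lt (lt_of_le_of_lt (min_le_right _ _) (by linarith)) hηA⟩
    exact continuous_const.mul (hFan.deriv.continuousOn.comp_continuous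
      ((continuous_id.min continuous_const).max continuous_const) hclamp)
  · intro b hb
    have hbA : b ∈ Ioo 0 ηA := ⟨hb.1, hb.2.trans (by linarith)⟩
    have hnhds : Literature.MathematicalPhysics.KineticTheory.hsExcessFreeEnergy =ᶠ[𝓝 b] F :=
      Filter.eventuallyEq_of_mem (isOpen_Ioo.mem_nhds hbA) (hFeq.mono Ioo_subset_Ico_self)
    simp only [contactValue]
    rw [min_eq_left hb.2.le, max_eq_left hb.1.le, hnhds.deriv_eq]

/-- The window cutoff `max 0 (min 1 (2 − 2a/η))` vanishes on `[η, ∞)` (`0 < η`). [folklore] -/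
theorem cutoff_eq_zero {η a : ℝ} (hη : 0 < η) (ha : η ≤ a) : max 0 (min 1 (2 - 2 * a / η)) = 0 := by
  have h : 2 ≤ 2 * a / η := by rw [le_div_iff₀ hη]; linarith
  rw [min_eq_right (by linarith), max_eq_left (by linarith)]

/-- The window cutoff equals `1` where `2a ≤ η` (`0 < η`). [folklore] -/
theorem cutoff_eq_one {η a : ℝ} (hη : 0 < η) (ha : 2 * a ≤ η) : max 0 (min 1 (2 - 2 * a / η)) = 1 := by
  have h : 2 * a / η ≤ 1 := (div_le_one hη).2 ha
  rw [min_eq_left (by linarith), max_eq_right zero_le_one]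

/-! ## Collision sums: weights are only read on `[0, τ] × 𝕋³`; nothing happens at the instant `0` -/

/-- The even collision sum over `[0, τ]` only reads its weight on `[0, τ] × 𝕋³`. [folklore] -/
theorem collisionSum_congr_weight {σ : ℝ} {N : ℕ}
    (Ψ : HardSphereFlow (Literature.Analysis.FluidPDE.Torus.geometry (Fin 3)) (hsDiameter σ N) (N + 1))
    {τ : ℝ} {χ χ' : ℝ × T3 → ℝ} (h : ∀ s ∈ Icc 0 τ, ∀ x, χ (s, x) = χ' (s, x)) (g : ℝ → ℝ)
    (Ξ : V3 × V3 × V3 → ℝ) (r : ℝ) (z : Cfg N) : collisionSum σ N Ψ τ χ g Ξ r z = collisionSum σ N Ψ τ χ' g Ξ r z := by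
  unfold collisionSum
  dsimp only
  congr 1
  refine finsum_mem_congr rfl fun s hs => Finset.sum_congr rfl fun i _ => Finset.sum_congr rfl fun j _ => ?_
  rw [h s hs.2]

/-- On a good datum outside every contact set there is no collision at the instant `0` (`Φ_0 = id`), so every
even collision sum over `[0, 0]` vanishes. [folklore] -/
theorem collisionSum_at_zero {σ : ℝ} {N : ℕ}
    (Ψ : HardSphereFlow (Literature.Analysis.FluidPDE.Torus.geometry (Fin 3)) (hsDiameter σ N) (N + 1))
    {z : Cfg N} (hz : z ∈ Ψ.good) (hnc : ∀ i j : Fin (N + 1), i ≠ j →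
      z ∉ contactSet (Literature.Analysis.FluidPDE.Torus.geometry (Fin 3)) (N + 1) (hsDiameter σ N) i j)
    (χ : ℝ × T3 → ℝ) (g : ℝ → ℝ) (Ξ : V3 × V3 × V3 → ℝ) (r : ℝ) : collisionSum σ N Ψ 0 χ g Ξ r z = 0 := by
  -- adapted from the proof of `ParityBandClosurePressureValue.measure_cpv_zero`
  have hempty : collisionTimes (Literature.Analysis.FluidPDE.Torus.geometry (Fin 3)) (hsDiameter σ N)
      (fun s => Ψ.flow s z) ∩ Icc 0 0 = ∅ := by
    refine Set.eq_empty_iff_forall_notMem.2 ?_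
    rintro s ⟨⟨i, j, hij, hc⟩, hs0, hs1⟩
    obtain rfl : s = 0 := le_antisymm hs1 hs0
    refine hnc i j hij ?_
    have h' := hc
    simp only at h'
    rwa [Ψ.flow_zero z hz] at h'
  unfold collisionSum
  dsimp only
  rw [hempty, finsum_mem_empty, mul_zero]

/-- No collision time lies in `(0, 0] = ∅`: `M_N^A(z, 0) = 0`. [folklore] -/
theorem MfunA_zero (σ : ℝ) (Φ : Flows σ) (A : ℝ → T3 → Fin 3 → Fin 3 → ℝ) (N : ℕ) (z : Cfg N) :
    MfunA σ Φ A N z 0 = 0 := by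
  simp only [MfunA, Set.Ioc_self, HardSphereFlow.collisionPairSum,
    Literature.Analysis.FluidPDE.collisionPairSum_empty, mul_zero]

/-- The value functionals over the null window `[0, 0]` vanish. [folklore] -/
theorem RhsA_add_KfunA_zero (σ : ℝ) (Φ : Flows σ) (φ : ℕ → T3 → ℝ) (A : ℝ → T3 → Fin 3 → Fin 3 → ℝ)
    (N : ℕ) (z : Cfg N) : RhsA σ Φ φ A N z 0 + KfunA σ Φ φ A N z 0 = 0 := by
  have h0 : (volume : Measure ℝ).restrict (Icc 0 0) = 0 := Measure.restrict_eq_zero.2 (by simp)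
  simp only [RhsA, KfunA, h0, integral_zero_measure, add_zero]

/-! ## The deterministic core along one good orbit -/

/-- **Deterministic core of the dock.** On a good orbit with no contact pair at the instant `0`, along which the
window cutoff is inert (`2σ³ρ_r ≤ η₀'` on `[0, t]`) and on which the nine `EvenStressEnskog` statistics with the
clamped weights `χ_kl(s, x) = A(projIcc s, x)_kl` are `≤ η'` in modulus: `|M_N^A(τ) − (RhsA + KfunA)[b_r](τ)| ≤ (9/2)η'`
([DψA'] for `M_N^A(τ) = ½Σ_kl K_kl(τ)`; `sum_enskog_integral_eq` + [ConeVal] + `g = 1` for the value). [folklore] -/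
theorem core_bound {σ r t τ η₀' ηB η' : ℝ} {Yt : ℝ → ℝ} (hσ : 0 < σ) (hhalf : σ ≤ 1 / 2)
    (hr : 0 < r) (hr2 : r < 1 / 2) (ht : 0 < t) (hτ : τ ∈ Icc 0 t) (hη₀' : 0 < η₀') (hle : η₀' ≤ ηB)
    (hYt : Continuous Yt) (hYeq : ∀ b ∈ Ioo 0 ηB, Yt b = contactValue b)
    (Φ : Flows σ) {N : ℕ} {z : Cfg N} (hz : z ∈ (Φ N).good) (hnc : ∀ i j : Fin (N + 1), i ≠ j →
      z ∉ contactSet (Literature.Analysis.FluidPDE.Torus.geometry (Fin 3)) (N + 1) (hsDiameter σ N) i j)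
    {A : ℝ → T3 → Fin 3 → Fin 3 → ℝ} (hA : SmoothMatrixOn (Icc 0 t) A)
    (hinert : ∀ s ∈ Icc 0 t, ∀ x : T3, 2 * (σ ^ 3 * mollDensity r ((Φ N).flow s z) x) ≤ η₀')
    (hF : ∀ k l : Fin 3, |evenStat σ N (Φ N) τ (fun p : ℝ × T3 => A (projIcc 0 t ht.le p.1) p.2 k l)
      (fun a : ℝ => max 0 (min 1 (2 - 2 * a / η₀'))) (evenMark k l) r z| ≤ η') :
    |MfunA σ Φ A N z τ - (RhsA σ Φ (fun (_ : ℕ) (y : T3) => coneKernel r y 0) A N z τ +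
      KfunA σ Φ (fun (_ : ℕ) (y : T3) => coneKernel r y 0) A N z τ)| ≤ 9 / 2 * η' := by
  set g : ℝ → ℝ := fun a => max 0 (min 1 (2 - 2 * a / η₀')) with hg_def
  set a : Fin 3 → Fin 3 → ℝ × T3 → ℝ := fun k l p => A (projIcc 0 t ht.le p.1) p.2 k l with ha_def
  have hgc : Continuous g := by rw [hg_def]; fun_prop
  have hg0 : ∀ b, η₀' ≤ b → g b = 0 := fun b hb => cutoff_eq_zero hη₀' hb
  have hg1 : ∀ s ∈ Icc 0 t, ∀ x, g (σ ^ 3 * mollDensity r ((Φ N).flow s z) x) = 1 := fun s hs x =>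
    cutoff_eq_one hη₀' (hinert s hs x)
  have hac : ∀ k l, Continuous (a k l) := fun k l => continuous_comp_projIcc ht (hA k l)
  have hproj : ∀ {s}, s ∈ Icc 0 τ → ∀ (x : T3) (k l : Fin 3), a k l (s, x) = A s x k l := fun hs x k l => by
    simp only [ha_def, projIcc_of_mem ht.le ⟨hs.1, hs.2.trans hτ.2⟩]
  -- (1) [DψA']: the mark sum is one half of the even collision sums (clamped = unclamped weights on `[0, τ]`)
  have h1 : MfunA σ Φ A N z τ = 1 / 2 * ∑ k, ∑ l, collisionSum σ N (Φ N) τ (a k l) g (evenMark k l) r z := by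
    have hW := stub_markSumA_eq_evenCollisionSums_of_inert σ hσ hhalf η₀' r hη₀' hr Φ N z hz t hinert A 0 τ
      le_rfl hτ.1 hτ.2
    rw [MfunA_zero, sub_zero] at hW
    rw [hW]
    refine congrArg _ (Finset.sum_congr rfl fun k _ => Finset.sum_congr rfl fun l _ => ?_)
    rw [collisionSum_at_zero (Φ N) hz hnc, sub_zero]
    exact collisionSum_congr_weight (Φ N) (fun s hs x => (hproj hs x k l).symm) _ _ _ _
  -- (2) the summed Enskog predictions (landed macroscale identity); (3) one half of it is the line's value
  have h2 := ParityBandClosurePressureValue.sum_enskog_integral_eq (N := N) (t := τ) hYeq hg0 hle hη₀' hσ hr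
    hac hgc hYt (Φ N) hz
  have h3 : RhsA σ Φ (fun (_ : ℕ) (y : T3) => coneKernel r y 0) A N z τ +
      KfunA σ Φ (fun (_ : ℕ) (y : T3) => coneKernel r y 0) A N z τ =
      1 / 2 * ∑ k, ∑ l, σ ^ 3 * ∫ s in Icc 0 τ, enskogRate σ N (a k l) g (evenMark k l) r s ((Φ N).flow s z) := by
    have hhalf' : ∀ u v : ℝ, 1 / 2 * (2 * u + 8 * Real.pi / 15 * v) = u + 4 * Real.pi / 15 * v := by
      intro u v; ring
    rw [h2, hhalf']
    congr 1
    · refine setIntegral_congr_fun measurableSet_Icc fun s hs => integral_congr_ae (ae_of_all _ fun x => ?_)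
      beta_reduce
      rw [ConeValue.rhoB_cone, ConeValue.thetaB_cone, hg1 s ⟨hs.1, hs.2.trans hτ.2⟩ x]
      simp only [trW, pcoll, hproj hs]
      ring
    · unfold KfunA
      rw [← integral_const_mul]
      refine setIntegral_congr_fun measurableSet_Icc fun s hs => ?_
      have hs' : s ∈ Icc 0 t := ⟨hs.1, hs.2.trans hτ.2⟩
      rw [← integral_const_mul]
      refine integral_congr_ae (ae_of_all _ fun x => ?_)
      beta_reduce
      have hW7 := stub_coneValue_eq σ r η₀' ηB Yt g hYeq hg0 hle hη₀' hσ hr hr2 A s N ((Φ N).flow s z) x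
      rw [ConeValue.rhoB_cone, ConeValue.thetaB_cone, hg1 s hs' x] at hW7 ⊢
      simp only [trW, pcoll, hproj hs, one_mul, mul_one] at hW7 ⊢
      linarith
  -- (4) the nine statistics
  have h4 : |(∑ k, ∑ l, collisionSum σ N (Φ N) τ (a k l) g (evenMark k l) r z) -
      ∑ k, ∑ l, σ ^ 3 * ∫ s in Icc 0 τ, enskogRate σ N (a k l) g (evenMark k l) r s ((Φ N).flow s z)| ≤
      ∑ _k : Fin 3, ∑ _l : Fin 3, η' := by
    rw [← Finset.sum_sub_distrib]
    refine (Finset.abs_sum_le_sum_abs _ _).trans (Finset.sum_le_sum fun k _ => ?_)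
    rw [← Finset.sum_sub_distrib]
    exact (Finset.abs_sum_le_sum_abs _ _).trans (Finset.sum_le_sum fun l _ => hF k l)
  rw [show (∑ _k : Fin 3, ∑ _l : Fin 3, η') = 9 * η' by simp; ring] at h4
  rw [h1, h3, ← mul_sub, abs_mul, abs_of_pos (by norm_num : (0 : ℝ) < 1 / 2)]
  linarith

end DockA

/-- **Registered stub [DockA] `stub_stressLawFixedA_of_evenStressEnskog` (line hemisphere-affine-slaving, crux
`CollisionalTransferLocality`, stmt-AtomisticToContinuum-9518): THE MOMENTUM ENGINE FROM THE SIBLING CRUX.**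
`EvenStressEnskog` (13079, by name) ∧ [TS] ⟹ [KσA] (`σ₀ := min σ_E (min σ_T (1/2))`, `η₁ := min η_T (η₀'/8)`,
`η₀' := min η₀ η_B`): `τ = 0` is the empty event; for `τ > 0`, radii and particle numbers from nine instances of
13079 (clamped weights, window cutoff), one of [TS], `DiluteAt` and `(N+1)^{-γ} ≪ r`; union bound off the null set
(bad set ∪ contact sets) through the deterministic core `DockA.core_bound` and [TS]. [folklore] -/
theorem stub_stressLawFixedA_of_evenStressEnskog : Summit.AtomisticToContinuum.HydrodynamicLimit.Theses.JParityClosure.EvenStressEnskog → (∀ (a₀ θ₀ : T3 → ℝ) (u₀ : T3 → V3), NiceProfiles a₀ θ₀ u₀ → ∃ σ₀ : ℝ, 0 < σ₀ ∧ ∃ η₁ : ℝ, 0 < η₁ ∧ ∀ σ : ℝ, 0 < σ → σ < σ₀ → ∀ (Φ : Flows σ) (t : ℝ), 0 < t → ∀ (γ C : ℝ) (φ : ℕ → T3 → ℝ), 0 < γ → γ ≤ 1 / 15 → AdmissibleKernel γ C φ → DiluteAt σ a₀ θ₀ u₀ Φ t φ η₁ → ∀ (A : ℝ → T3 → Fin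 3 → Fin 3 → ℝ), SmoothMatrixOn (Icc 0 t) A → ∀ τ ∈ Icc 0 t, ∀ η δ : ℝ, 0 < η → 0 < δ → ∃ r₀ : ℝ, 0 < r₀ ∧ ∀ r : ℝ, 0 < r → r < r₀ → ∃ N₀ : ℕ, ∀ N : ℕ, N₀ ≤ N → Literature.MathematicalPhysics.KineticTheory.localGibbsLaw σ a₀ u₀ θ₀ N (Φ N) {z | η < |(RhsA σ Φ (fun (_ : ℕ) (y : T3) => Literature.MathematicalPhysics.KineticTheory.coneKernel r y 0) A N z τ + KfunA σ Φ (fun (_ : ℕ) (y : T3) => Literature.MathematicalPhysics.KineticTheory.coneKernel r y 0) A N z τ) - (RhsA σ Φ φ A N z τ + KfunA σ Φ φ A N z τ)|} ≤ ENNReal.ofReal δ) → ∀ (a₀ θ₀ : T3 → ℝ) (u₀ : T3 → V3), NiceProfiles a₀ θ₀ u₀ → ∃ σ₀ : ℝ, 0 < σ₀ ∧ ∃ η₁ : ℝ, 0 < η₁ ∧ ∀ σ : ℝ, 0 < σ → σ < σ₀ → ∀ (Φ : Flows σ) (t : ℝ), 0 < t → VirialBounded σ a₀ θ₀ u₀ Φ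 t → ∀ (γ C : ℝ) (φ : ℕ → T3 → ℝ), 0 < γ → γ ≤ 1 / 15 → AdmissibleKernel γ C φ → DiluteAt σ a₀ θ₀ u₀ Φ t φ η₁ → ∀ (A : ℝ → T3 → Fin 3 → Fin 3 → ℝ), SmoothMatrixOn (Icc 0 t) A → StressLawFixedAAt σ a₀ θ₀ u₀ Φ φ t A := by
  intro h79 hTS a₀ θ₀ u₀ hP
  have hP' := hP
  obtain ⟨ha, hθ, hu, ha0, hθ0⟩ := hP'
  obtain ⟨η₀, hη₀, H79⟩ := h79
  obtain ⟨σE, hσE, HE1⟩ := H79 a₀ θ₀ u₀ ha hθ hu ha0 hθ0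
  obtain ⟨σT, hσT, ηT, hηT, HT1⟩ := hTS a₀ θ₀ u₀ hP
  obtain ⟨ηB, hηB, Yt, hYt, hYeq⟩ := DockA.exists_band_function
  obtain ⟨c, hc0, Hceil⟩ := stub_mollDensity_le_of_blockCeiling
  -- thresholds: cutoff radius `η₀' ≤ η₀, η_B`; dilute level `min η_T (η₀'/8)`; `σ₀ = min σ_E (min σ_T (1/2))`
  set η₀' : ℝ := min η₀ ηB with hη₀'_def
  have hη₀' : 0 < η₀' := lt_min hη₀ hηB
  refine ⟨min σE (min σT (1 / 2)), lt_min hσE (lt_min hσT (by norm_num)), min ηT (η₀' / 8),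
    lt_min hηT (by positivity), ?_⟩
  intro σ hσ hlt Φ t ht _hV γ C φ hγ hγ' hadm hDil A hA τ hτ δ hδ
  have hltE : σ < σE := lt_of_lt_of_le hlt (min_le_left _ _)
  have hltT : σ < σT := lt_of_lt_of_le hlt ((min_le_right _ _).trans (min_le_left _ _))
  have hhalf : σ ≤ 1 / 2 := (lt_of_lt_of_le hlt ((min_le_right _ _).trans (min_le_right _ _))).le
  have hη₁' : min ηT (η₀' / 8) ≤ η₀' / 8 := min_le_right _ _
  have hDilT : DiluteAt σ a₀ θ₀ u₀ Φ t φ ηT := by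
    refine tendsto_of_tendsto_of_tendsto_of_le_of_le tendsto_const_nhds hDil (fun _ => bot_le)
      fun N => measure_mono ?_
    rintro z ⟨s, hs, x, hx⟩
    exact ⟨s, hs, x, (min_le_left _ _).trans_lt hx⟩
  rcases hτ.1.eq_or_lt with h0 | hτpos
  · -- the instant `τ = 0`: the event is empty
    subst h0
    have hE : ∀ N, {z : Cfg N | δ < |MfunA σ Φ A N z 0 - (RhsA σ Φ φ A N z 0 + KfunA σ Φ φ A N z 0)|} = ∅ := by
      refine fun N => Set.eq_empty_iff_forall_notMem.2 fun z hz => ?_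
      rw [mem_setOf_eq, DockA.MfunA_zero, DockA.RhsA_add_KfunA_zero, sub_zero, abs_zero] at hz
      exact lt_irrefl _ (hδ.trans hz)
    simp only [hE, measure_empty]
    exact tendsto_const_nhds
  -- `0 < τ`
  set P : (N : ℕ) → Measure (Cfg N) := fun N => localGibbsLaw σ a₀ u₀ θ₀ N (Φ N) with hP_def
  refine DockA.tendsto_zero_of_le_ofReal fun e he => ?_
  have he' : 0 < e / 11 := by positivity
  have hη' : 0 < δ / 30 := by positivity
  -- the window cutoff and the clamped (jointly continuous) weights
  set g : ℝ → ℝ := fun a => max 0 (min 1 (2 - 2 * a / η₀')) with hg_def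
  set a : Fin 3 → Fin 3 → ℝ × T3 → ℝ := fun k l p => A (projIcc 0 t ht.le p.1) p.2 k l with ha_def
  have hgc : Continuous g := by rw [hg_def]; fun_prop
  have hg0E : ∀ b, η₀ ≤ b → g b = 0 := fun b hb => DockA.cutoff_eq_zero hη₀' ((min_le_left _ _).trans hb)
  have hac : ∀ k l, Continuous (a k l) := fun k l => continuous_comp_projIcc ht (hA k l)
  -- radii: nine instances of `EvenStressEnskog` and one of [TS]
  have hE2 : ∀ p : Fin 3 × Fin 3, ∃ r₀ : ℝ, 0 < r₀ ∧ ∀ r : ℝ, 0 < r → r < r₀ → ∃ N₀ : ℕ, ∀ N : ℕ, N₀ ≤ N →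
      ∀ k l : Fin 3, P N {z | δ / 30 < |evenStat σ N (Φ N) τ (a p.1 p.2) g (evenMark k l) r z|} ≤
        ENNReal.ofReal (e / 11) :=
    fun p => HE1 σ hσ hltE Φ τ hτpos (a p.1 p.2) (hac p.1 p.2) g hgc hg0E (δ / 30) (e / 11) hη' he'
  choose rE hrE HE3 using hE2
  obtain ⟨rT, hrT, HT3⟩ := HT1 σ hσ hltT Φ t ht γ C φ hγ hγ' hadm hDilT A hA τ hτ (δ / 3) (e / 11)
    (by positivity) he'
  set r : ℝ := min (min rT (Finset.univ.inf' Finset.univ_nonempty rE)) (1 / 8) / 2 with hr_def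
  have hmin : 0 < min (min rT (Finset.univ.inf' Finset.univ_nonempty rE)) (1 / 8) :=
    lt_min (lt_min hrT ((Finset.lt_inf'_iff _).2 fun p _ => hrE p)) (by norm_num)
  have hr : 0 < r := by positivity
  have hrlt : r < min (min rT (Finset.univ.inf' Finset.univ_nonempty rE)) (1 / 8) := by rw [hr_def]; linarith
  have hrE' : ∀ p, r < rE p := fun p => hrlt.trans_le
    ((min_le_left _ _).trans ((min_le_right _ _).trans (Finset.inf'_le _ (Finset.mem_univ p))))
  have hr4 : r < 1 / 4 := by linarith [hrlt.trans_le (min_le_right _ _)]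
  -- particle numbers: [TS], 13079, the dilute event, the mesoscale against `r`
  obtain ⟨NT, HT4⟩ := HT3 r hr (hrlt.trans_le ((min_le_left _ _).trans (min_le_left _ _)))
  choose NE HE5 using fun p => HE3 p r hr (hrE' p)
  obtain ⟨ND, HD⟩ := eventually_atTop.1 (((tendsto_order.1 hDil).2 _ (ENNReal.ofReal_pos.2 he')).mono
    fun N h => h.le)
  have hρ0 : 0 < min r (r / (c + 1)) := lt_min hr (div_pos hr (by linarith))
  obtain ⟨Nγ, Hγ⟩ := eventually_atTop.1 (((tendsto_rpow_neg_atTop hγ).comp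
    (tendsto_atTop_add_const_right atTop (1 : ℝ) tendsto_natCast_atTop_atTop)).eventually (gt_mem_nhds hρ0))
  refine ⟨max (max NT ND) (max Nγ (Finset.univ.sup NE)), fun N hN => ?_⟩
  have hNT : NT ≤ N := ((le_max_left _ _).trans (le_max_left _ _)).trans hN
  have hND : ND ≤ N := ((le_max_right _ _).trans (le_max_left _ _)).trans hN
  have hNE : ∀ p, NE p ≤ N := fun p =>
    (Finset.le_sup (Finset.mem_univ p)).trans (((le_max_right _ _).trans (le_max_right _ _)).trans hN)
  have hℓ : ((N : ℝ) + 1) ^ (-γ) < min r (r / (c + 1)) := Hγ N (((le_max_left _ _).trans (le_max_right _ _)).trans hN)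
  have hℓ0 : 0 ≤ ((N : ℝ) + 1) ^ (-γ) := Real.rpow_nonneg (by positivity) _
  have hℓr : ((N : ℝ) + 1) ^ (-γ) ≤ r := (hℓ.trans_le (min_le_left _ _)).le
  have hcℓ : c * ((N : ℝ) + 1) ^ (-γ) ≤ r := by
    have h1 := (lt_div_iff₀ (by linarith : (0 : ℝ) < c + 1)).1 (hℓ.trans_le (min_le_right _ _))
    nlinarith
  -- the three small events add up to at most `e`
  have hfin := (add_le_add (HD N hND) (add_le_add (HT4 N hNT) ((measure_biUnion_finset_le _ _).trans
    (Finset.sum_le_sum fun p (_ : p ∈ Finset.univ) => HE5 p N (hNE p) p.1 p.2)))).trans (DockA.two_add_nine e he.le).le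
  -- the null set: the bad set of the flow and the contact sets
  set S : Finset (Fin (N + 1) × Fin (N + 1)) := Finset.univ.filter fun p => p.1 ≠ p.2 with hS
  have hnull : P N ((Φ N).goodᶜ ∪ ⋃ p ∈ S,
      contactSet (Literature.Analysis.FluidPDE.Torus.geometry (Fin 3)) (N + 1) (hsDiameter σ N) p.1 p.2)ᶜᶜ = 0 := by
    rw [compl_compl, hP_def]
    exact measure_union_null (localGibbsLaw_compl_good' (Φ N))
      ((measure_biUnion_null_iff (Finset.countable_toSet S)).2 fun p hp =>
        ParityBandClosurePressureValue.localGibbsLaw_contactSet hσ a₀ θ₀ u₀ N (Φ N) (Finset.mem_filter.1 hp).2)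
  -- the union bound off the null set: on a good, dilute, two-scale-close datum one of the nine statistics is large
  refine (measure_le_of_imp3 (P N) hnull fun z hzE hzG hzD hzT => ?_).trans hfin
  have hz : z ∈ (Φ N).good := by
    by_contra h
    exact hzG (Or.inl h)
  have hnc : ∀ i j : Fin (N + 1), i ≠ j →
      z ∉ contactSet (Literature.Analysis.FluidPDE.Torus.geometry (Fin 3)) (N + 1) (hsDiameter σ N) i j :=
    fun i j hij h => hzG (Or.inr (mem_iUnion₂.2 ⟨(i, j), Finset.mem_filter.2 ⟨Finset.mem_univ _, hij⟩, h⟩))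
  by_contra hzF
  simp only [mem_iUnion, exists_prop, Finset.mem_univ, true_and, not_exists, not_and, mem_setOf_eq,
    not_lt] at hzF hzD hzT
  -- [CeilR]: the block ceiling is an `r`-ceiling, so the cutoff is inert along the orbit
  have hinert : ∀ s ∈ Icc 0 t, ∀ x : T3, 2 * (σ ^ 3 * mollDensity r ((Φ N).flow s z) x) ≤ η₀' := by
    intro s hs x
    have hσ3 : 0 < σ ^ 3 := pow_pos hσ 3
    have h := Hceil γ C φ hγ hadm r hr hr4 N hℓr (min ηT (η₀' / 8) / σ ^ 3) (by positivity) ((Φ N).flow s z)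
      (fun y => by rw [le_div_iff₀ hσ3]; exact hzD s hs y) x
    have h2 : c * ((N : ℝ) + 1) ^ (-γ) / r ≤ 1 := (div_le_one hr).2 hcℓ
    have h3 : mollDensity r ((Φ N).flow s z) x ≤ min ηT (η₀' / 8) / σ ^ 3 * 2 :=
      h.trans (mul_le_mul_of_nonneg_left (by linarith) (by positivity))
    rw [div_mul_eq_mul_div, le_div_iff₀ hσ3] at h3
    nlinarith [hη₁', h3, hσ3, hη₀']
  have hcore := DockA.core_bound (η' := δ / 30) hσ hhalf hr (by linarith) ht hτ hη₀' (min_le_right _ _) hYt hYeq Φ hz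
    hnc hA hinert fun k l => hzF (k, l)
  rw [mem_setOf_eq] at hzE
  linarith [(abs_sub_le _ _ _).trans (add_le_add hcore hzT)]

end

end Summit.AtomisticToContinuum.HydrodynamicLimit.Theorems.HemisphereAffineSlaving
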